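import Mathlib.AlgebraicGeometry.EllipticCurve.VariableChange
import HarnessLib

/-!
# WLOG `0 < A < B` for the Legendre model `y² = x(x − A)(x − B)` (E-es-185 STEP 2–3 glue, `E`-free)
(route `ManinLocalTwoThree`, crux C2 `ManinOddAtFour` stmt-BirchSwinnertonDyer-22967; cell bsd-f2-manin, C2/C3 LEAD p1 gen 19;
`--supports stmt-BirchSwinnertonDyer-22967`; line card `Lines/kummer_diamond.md`: feeds D6 `…KummerDiamondDescentStepTwo`
(`descent_table_of_diamond_classes` wants the ORDERED root differences `0 < A < B`) from p2's `exists_legendre_of_index_four` /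
`exists_variableChange_eq_legendre` (which give `A, B ≠ 0`, `A ≠ B` unordered))

es g38's STEP 3 (§59.13(b)) orders the 2-torsion abscissae `e₁ < e₂ < e₃` ("with `e₁ < e₂ < e₃` both `δ(T₁)` and `δ(T₂)` have sign
pattern `(+,−,−)`").  For a curve already in Legendre form `⟨0, −(A+B), 0, AB, 0⟩` (roots `0, A, B` of the 2-division cubic) this is the
translation `x ↦ x + m`, `m = min{0, A, B}`, followed by relabelling: `exists_legendre_ordered`.  Elementary; nothing about C2, Manin's
conjecture or BSD is proved here.
-/

set_option autoImplicit false
-- lint-debt: the directory name repeats the summit name (sibling precedent `ManinLocalTwoThreeKummerDiamondDescentCases.lean`)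
set_option linter.dupNamespace false

namespace Summit.BirchSwinnertonDyer.BirchSwinnertonDyer.Theorems.ManinLocalTwoThree.KummerDiamondLegendre

open WeierstrassCurve

/-- The Legendre model is symmetric in `A, B`. [folklore] -/
theorem legendre_swap (A B : ℚ) :
    (⟨0, -(A + B), 0, A * B, 0⟩ : WeierstrassCurve ℚ) = ⟨0, -(B + A), 0, B * A, 0⟩ := by
  ext <;> simp only <;> ring

/-- Translating `x ↦ x + A` moves the roots `{0, A, B}` to `{−A, 0, B − A}`: the change of variables `(1, A, 0, 0)` carries
`y² = x(x − A)(x − B)` to `y² = x(x + A)(x − (B − A))`. [folklore] -/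
theorem shift_legendre (A B : ℚ) :
    (⟨1, A, 0, 0⟩ : VariableChange ℚ) • (⟨0, -(A + B), 0, A * B, 0⟩ : WeierstrassCurve ℚ) =
      ⟨0, -((-A) + (B - A)), 0, (-A) * (B - A), 0⟩ := by
  ext
  · rw [WeierstrassCurve.variableChange_a₁]; simp
  · rw [WeierstrassCurve.variableChange_a₂]; simp only [inv_one, Units.val_one, one_pow, one_mul]; ring
  · rw [WeierstrassCurve.variableChange_a₃]; simp
  · rw [WeierstrassCurve.variableChange_a₄]; simp only [inv_one, Units.val_one, one_pow, one_mul]; ring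
  · rw [WeierstrassCurve.variableChange_a₆]; simp only [inv_one, Units.val_one, one_pow, one_mul]; ring

/-- **WLOG `0 < A < B`.**  If some change of variables carries `W/ℚ` to a Legendre model `⟨0, −(A+B), 0, AB, 0⟩` with `A, B ≠ 0`,
`A ≠ B`, then another one carries it to a Legendre model with ORDERED positive parameters `0 < A' < B'`. [folklore] -/
theorem exists_legendre_ordered (W : WeierstrassCurve ℚ) {C : VariableChange ℚ} {A B : ℚ}
    (hC : C • W = ⟨0, -(A + B), 0, A * B, 0⟩) (hA : A ≠ 0) (hB : B ≠ 0) (hAB : A ≠ B) :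
    ∃ (C' : VariableChange ℚ) (A' B' : ℚ), 0 < A' ∧ A' < B' ∧ C' • W = ⟨0, -(A' + B'), 0, A' * B', 0⟩ := by
  -- the three translated models available: roots based at `0`, at `A`, at `B`
  have h0 : C • W = ⟨0, -(B + A), 0, B * A, 0⟩ := by rw [hC, legendre_swap]
  have hA' : ((⟨1, A, 0, 0⟩ : VariableChange ℚ) * C) • W = ⟨0, -((-A) + (B - A)), 0, (-A) * (B - A), 0⟩ := by
    rw [mul_smul, hC, shift_legendre]
  have hA'' : ((⟨1, A, 0, 0⟩ : VariableChange ℚ) * C) • W = ⟨0, -((B - A) + (-A)), 0, (B - A) * (-A), 0⟩ := by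
    rw [hA', legendre_swap]
  have hB' : ((⟨1, B, 0, 0⟩ : VariableChange ℚ) * C) • W = ⟨0, -((-B) + (A - B)), 0, (-B) * (A - B), 0⟩ := by
    rw [mul_smul, h0, shift_legendre]
  have hB'' : ((⟨1, B, 0, 0⟩ : VariableChange ℚ) * C) • W = ⟨0, -((A - B) + (-B)), 0, (A - B) * (-B), 0⟩ := by
    rw [hB', legendre_swap]
  rcases lt_or_gt_of_ne hAB with hlt | hlt
  · -- `A < B`
    rcases lt_or_gt_of_ne hA with hA0 | hA0
    · -- `A < 0`: base at `A`; roots `−A, B − A > 0`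
      rcases lt_or_gt_of_ne hB with hB0 | hB0
      · exact ⟨_, _, _, by linarith, by linarith, hA''⟩
      · exact ⟨_, _, _, by linarith, by linarith, hA'⟩
    · -- `0 < A < B`
      exact ⟨C, A, B, hA0, hlt, hC⟩
  · -- `B < A`
    rcases lt_or_gt_of_ne hB with hB0 | hB0
    · -- `B < 0`: base at `B`; roots `−B, A − B > 0`
      rcases lt_or_gt_of_ne hA with hA0 | hA0
      · exact ⟨_, _, _, by linarith, by linarith, hB''⟩
      · exact ⟨_, _, _, by linarith, by linarith, hB'⟩
    · -- `0 < B < A`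
      exact ⟨C, B, A, hB0, hlt, h0⟩

end Summit.BirchSwinnertonDyer.BirchSwinnertonDyer.Theorems.ManinLocalTwoThree.KummerDiamondLegendre
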